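import Summits.QuantumFields.YangMills.Theses.HyperbolicRegulator

/-!
# Birth skeleton (BC3) for crux `CurvatureUniformity` (stmt-QuantumFields-15825) — `Lines/birth.lean`

Registrar: `planner-skel-stmt-QuantumFields-15825-0` (skeleton-register one-shot; route
`route-QuantumFields-HyperbolicRegulator`, sub `YangMills`, re-audit bin REPAIRABLE), 2026-08-17.

Crux (route file `Theses/HyperbolicRegulator.lean`, decl
`Summit.QuantumFields.YangMills.Theses.HyperbolicRegulator.CurvatureUniformity`, rank 2, THE crux of
the line): for every compact simple `G`, faithful unitary `r` and EVERY admissible hyperbolic family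
`Φ k j` (products `S × S` of finite square complexes of type `{4,5}_k`, curvature scale `k ≥ 8`,
separation index `j`; the `let Fam := …` vocabulary of the route), IF the anchor holds (one `c > 0`,
thresholds `β₀(k)`, clustering of chart-read gauge-invariant local observables at rate `c/k`,
uniformly in `j ≥ j₀`), THEN `∃ β₁ ∀ β ≥ β₁ ∃ m(β) > 0 ∀ k ≥ 8`: the same clustering at the ONE rate
`m(β)` (constants `C(β,k,A,B)`, `j ≥ j₀(β,k,A,B)`). In the 2001 archive's language: the boundary gap
grows linearly, `Δ₁(R) ≥ cR`.

## The cut: by curvature scale against an infrared threshold `K(β)` (the route's own foreseen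
two-layer plan "CurvatureWindow → CurvatureBeyondWindow → CurvatureUniformity", typed)

The crux's conclusion is `∃ m ∀ k`; the anchor gives `∀ k` only beyond `k`-DEPENDENT thresholds
`β₀(k)` and at the DECAYING rate `c/k`. Two things are missing and they are of different kinds:

* `stub_uniformOnset` (O — PER-SCALE GAP WITH A `k`-INDEPENDENT ONSET; the lattice form of 2001
  Thm A "`m(R) = Δ₁(R)/R > 0` at each radius"). Same data, same hypotheses as the crux; conclusion
  `∃ β₁ ∀ β ≥ β₁ ∀ k ≥ 8 ∃ m(β,k) > 0`: clustering at rate `m(β,k)`. It differs from the crux exactly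
  in the quantifier order (`∀ k ∃ m` against `∃ m ∀ k`) and from the anchor exactly in the band
  `β₁ ≤ β < β₀(k)`: for the intended Bałaban-mechanical anchor `β₀(k)` grows like `(11/3π²) log k`
  (`SU(2)`: weak coupling at every scale below `k` needs `ξ(β) ≫ k`), so O asserts a gap of the
  regulated theory at FIXED curvature scale `k` through the crossover `k ≍ ξ(β)` and beyond — no
  re-entrant gapless window at fixed `k`. Plausible even for `U(1)` (expander photon mass `≍ 1/k` at
  every `β`): O is essentially group-blind.
* `stub_infraredCore` (I — ASYMPTOTIC `k`-UNIFORMITY, the honest infrared core; the lattice form of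
  the 2001 crux restricted to `R ≳ ξ`). Same data and hypotheses; conclusion
  `∃ β₁ ∀ β ≥ β₁ ∃ m(β) > 0 ∃ K(β) ∀ k ≥ K(β)`: clustering at the one rate `m(β)`. Intended
  `K(β) ≍ ε·ξ(β)`: the flat `ℤ⁴` balls of radius `k/4` are then larger than the dynamical correlation
  length, and I says the curvature regulator can be removed at fixed `β` without losing the rate —
  it contains the weak-coupling mass gap of the flat Wilson theory seen from inside ever larger flat
  regions. FALSE for `U(1)` (rate `≍ 1/k → 0`): asymptotic freedom / non-abelianness enters the
  line exactly here, as the route's barrier note (`AbelianDeconfinementD4`) demands.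
* Composition `CurvatureUniformity_of : CurvatureUniformity` (stubs BY NAME; hypothesis form
  `CurvatureUniformity_of_hyps : I-statement → O-statement → CurvatureUniformity`, sorry-free):
  thresholds `max`, then for `β` fixed the window `8 ≤ k < K(β)` is FINITE, so the rate is the
  minimum of the core rate and finitely many per-scale rates (abstract gluing lemma
  `uniform_rate_of_core_of_onset`, any clustering predicate antitone in the rate), and the
  antitonicity of the route's clustering clause in the rate is proved THROUGH the `let Fam`
  vocabulary (`rate_weaken`: `C·e^{−m d} ≤ max(C,0)·e^{−m′ d}` for `m′ ≤ m`, `d ≥ 0`; the constant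
  `C(β,k,A,B)` is existential in the crux, so replacing it by `max C 0` is free).
  The final `example`s certify that the registered form is the hypothesis form at the stubs and
  that its type is literally the route decl.

Neither stub is the crux or the summit in disguise: O lacks the `k`-uniformity, I lacks the window
`k < K(β)`; each is a strict WEAKENING of the crux (so the converses `crux → stub` hold trivially —
by design: this is a factorisation `crux ⟺ I ∧ O`, not a transfer), neither mentions OS data,
schemes or `YangMills`, and neither follows from the anchor (O: the anchor's thresholds are
`k`-dependent; I: the anchor's rate `c/k` decays). The interface `K(β)` is existential (soft): the
intended division of labour is `K(β) ≍ ε ξ(β)` — I = flat regions beyond the correlation length,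
O = every fixed curvature scale incl. the crossover `k ≍ ξ(β)`, anchor = `k ≪ ξ(β)`.

BC3 probes (registrar folder `bc/`; import = the route file, which carries the crux and imports the
Statement; `maxHeartbeats 400000` each): per tactic — `exact?` 4/4 "could not close the goal",
`aesop (enableSimp := false)` 4/4 "failed, made no progress" on `⊢ CurvatureUniformity` /
`⊢ YangMills` (82 s); combined chain `first | exact? | simpa | simpa using h | simpa [crux] using h
| aesop` 4/4 FAIL (`exact?`, `simpa` fail, then deterministic timeout at `whnf`/`isDefEq` inside
`simpa using h`; 109 s + 107 s); the instruction's literal chain `first | exact? | simpa | aesop` 4/4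
FAIL (`exact?`, `simpa` fail, `aesop` times out in norm-simp; 176 s); `aesop` alone 4/4 and `simpa
using h` alone 4/4 FAIL (timeouts); `unfold CurvatureUniformity; exact h` 2/2 "Type mismatch";
converses `crux → stub` by `exact?` / `aesop (enableSimp := false)` also FAIL 4/4 (true by hand, not
cheap). Raw outputs: `Lines/birth.md`. Verdict bc3 PASS: 2 named stubs, sorries = stubs = 2, zero
elsewhere; no stub cheaply ≡ the crux or the summit.

## Disproof used

None exists: `Cruxes/CurvatureUniformity/` had no workfiles before this one (no `Disproof.lean`, no
`Theorems/CurvatureUniformity/Negative/`, no registered lines, no crux ideas; `ledger crux ls`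
2026-08-17). The summit's negatives index (5 refuted statements: RobustYangMillsRG,
MirrorModularBoosts/DiagonalMirrorRP, AdaptiveCoarseSystem, MultibosonLatticeGap,
AdmissibleRootsExist) has nothing on clustering of Wilson's theory on square complexes; neither stub
is an instance of any of them. Refuter evidence R3 on this item (2026-08-16, chart-radius /
admissibility VACUITY HAZARD shared by the three `Fam` copies; route bin REPAIRABLE) is inherited
verbatim and knowingly: both stubs copy the crux's `Fam`/`Sp`/`Φ` preamble byte for byte and differ
from it only in the final consequent, so a lockstep `--restate` of the crux re-types this skeleton
mechanically (swap the preamble; the gluing lemma is vocabulary-free).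

`lean check`: rc 0, errors []; sorries = 2 = stubs (`stub_infraredCore`, `stub_uniformOnset`), zero
elsewhere. Namespace `Summit.QuantumFields.YangMills.Cruxes.CurvatureUniformity.Birth`.
-/

set_option autoImplicit false

namespace Summit.QuantumFields.YangMills.Cruxes.CurvatureUniformity.Birth

open Summit.QuantumFields.YangMills.Theses.HyperbolicRegulator

/-- **Stub I — `stub_infraredCore`: asymptotic `k`-uniformity of the rate (OPEN; the honest
infrared core, hardest).** For every compact simple `G`, faithful unitary `r` and every admissible
hyperbolic family `Φ k j` (the route's `Fam` vocabulary, verbatim): IF the anchor holds (one `c > 0`,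
thresholds `β₀(k)`, clustering at rate `c/k` of chart-read gauge-invariant local observables of
support radius `≤ k/8` between flat base points of `S × S`, constants uniform in `j ≥ j₀`), THEN there
is `β₁` such that for every `β ≥ β₁` there are ONE rate `m > 0` and an infrared threshold `K` with:
for ALL curvature scales `k ≥ K` and all `A, B` of support radius `≤ k/8` there are `C, j₀` such that
for `j ≥ j₀` the clustering bound holds at rate `m`. (Intended `K(β) ≍ ε ξ(β)`: flat balls of radius
`k/4` beyond the correlation length; false for `U(1)`.) -/
theorem stub_infraredCore :
    open Literature.MathematicalPhysics.QuantumFieldTheory Literature.MathematicalPhysics.QuantumLattice MeasureTheory in ∀ (G : Type) [Group G] [TopologicalSpace G] [IsTopologicalGroup G] [CompactSpace G], IsCompactSimpleLieGroup G → letI : MeasurableSpace G := borel G; haveI : BorelSpace G := ⟨rfl⟩; ∀ r : LatticeRep G, let Fam := fun (k j : ℕ) (V E Q : Finset ℕ) (σ τ : ℕ → ℕ) (bd : ℕ → Fin 4 → ℕ × Bool) (cV : ℕ → ℤ × ℤ → ℕ) (cE : ℕ → ℤ × ℤ → Fin 2 → ℕ × Bool) => let st := fun e : ℕ × Bool =>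 if e.2 then σ e.1 else τ e.1; let en := fun e : ℕ × Bool => if e.2 then τ e.1 else σ e.1; let Γ := SimpleGraph.fromRel fun a b : ℕ => ∃ e ∈ E, σ e = a ∧ τ e = b; let dg := fun x : ℕ => (E.filter fun e => σ e = x ∨ τ e = x).card; let K := V.filter fun x => dg x = 5; let F := fun x : ℕ => x ∈ V ∧ ∀ c ∈ K, k / 4 < Γ.dist x c; let Dp := fun x : ℕ => x ∈ V ∧ ∀ c ∈ K, k / 2 < Γ.dist x c; let ib := fun a : ℤ × ℤ => |a.1| ≤ (k : ℤ) / 4 ∧ |a.2| ≤ (k : ℤ) / 4; let nx := fun (a : ℤ × ℤ) (μ : Fin 2) => if μ = 0 then (a.1 + 1, a.2) else (a.1, a.2 + 1); let Ed := (ℕ × ℕ) ⊕ (ℕ × ℕ); let PE : Finset Ed := (E ×ˢ V).disjSum (V ×ˢ E); let Cfg := ↥PE → G; let ν := Measure.pi fun _ : ↥PE => haarProbability G; let v := fun (U : Cfg) (e : Ed × Bool) => if h : e.1 ∈ PE then (if e.2 then U ⟨e.1, h⟩ else (U ⟨e.1, h⟩)⁻¹) else 1; let w := fun (U : Cfg)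 (e : Fin 4 → Ed × Bool) => (r.ρ (v U (e 0) * v U (e 1) * v U (e 2) * v U (e 3))).trace.re; let S := fun U : Cfg => (∑ q ∈ Q, ∑ y ∈ V, w U fun i => (Sum.inl ((bd q i).1, y), (bd q i).2)) + (∑ y ∈ V, ∑ q ∈ Q, w U fun i => (Sum.inr (y, (bd q i).1), (bd q i).2)) + ∑ e ∈ E, ∑ e' ∈ E, w U ![(Sum.inl (e, σ e'), true), (Sum.inr (τ e, e'), true), (Sum.inl (e, τ e'), false), (Sum.inr (σ e, e'), false)]; let d0 : Fin 4 → Fin 2 := ![0, 1, 0, 1]; let P := fun (x x' : ℕ) (U : Cfg) (p : ZdEdge 4) => let a := (p.1 0, p.1 1); let b := (p.1 2, p.1 3); if p.2 = 0 ∨ p.2 = 1 then v U (Sum.inl ((cE x a (d0 p.2)).1, cV x' b), (cE x a (d0 p.2)).2) else v U (Sum.inr (cV x a, (cE x' b (d0 p.2)).1), (cE x' b (d0 p.2)).2); ((∀ e ∈ E, σ e ∈ V ∧ τ e ∈ V ∧ σ e ≠ τ e) ∧ (∀ q ∈ Q, (∀ i, (bd q i).1 ∈ E) ∧ (∀ i,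 en (bd q i) = st (bd q (i + 1))) ∧ (st ∘ bd q).Injective) ∧ (∀ e ∈ E, (Q.filter fun q => ∃ i, (bd q i).1 = e).card = 2) ∧ (∀ x ∈ V, (dg x = 4 ∨ dg x = 5) ∧ (Q.filter fun q => ∃ i, st (bd q i) = x).card = dg x) ∧ (∀ x ∈ V, ∃ c ∈ K, Γ.dist x c ≤ k) ∧ (∀ c ∈ K, ∀ c' ∈ K, c ≠ c' → k ≤ Γ.dist c c') ∧ (∀ f : ℕ → ℝ, ∑ x ∈ V, f x = 0 → ∑ x ∈ V, f x ^ 2 ≤ 10 ^ 6 * (k : ℝ) ^ 2 * ∑ e ∈ E, (f (σ e) - f (τ e)) ^ 2) ∧ (∃ x y, Dp x ∧ Dp y ∧ j ≤ Γ.dist x y) ∧ (∀ x, F x → cV x (0, 0) = x ∧ (∀ a, ib a → cV x a ∈ V) ∧ Set.InjOn (cV x) {a | ib a} ∧ (∀ a μ, ib a → ib (nx a μ) → (cE x a μ).1 ∈ E ∧ st (cE x a μ) = cV x a ∧ en (cE x a μ) = cV x (nx a μ)) ∧ (∀ a, ib a → ib (a.1 + 1, a.2 + 1) → ∃ q ∈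 Q, Finset.univ.image (Prod.fst ∘ bd q) = {(cE x a 0).1, (cE x (nx a 0) 1).1, (cE x (nx a 1) 0).1, (cE x a 1).1})), fun (β m C : ℝ) (A B : YMSpecies G) => let X := fun f : Cfg → ℝ => (∫ U, f U * Real.exp (β * S U) ∂ν) / (∫ U, Real.exp (β * S U) ∂ν); ∀ x x' y y', F x → F x' → F y → F y' → |X (fun U => A.F (P x x' U) * B.F (P y y' U)) - X (fun U => A.F (P x x' U)) * X (fun U => B.F (P y y' U))| ≤ C * Real.exp (-(m * ((Γ.dist x y + Γ.dist x' y' : ℕ) : ℝ)))); let Sp := fun (A : YMSpecies G) (R : ℕ) => ∀ p ∈ A.supp, ∀ i, |p.1 i| ≤ (R : ℤ); ∀ (V E Q : ℕ → ℕ → Finset ℕ) (σ τ : ℕ → ℕ → ℕ → ℕ) (bd : ℕ → ℕ → ℕ → Fin 4 → ℕ × Bool) (cV : ℕ → ℕ → ℕ → ℤ × ℤ → ℕ) (cE : ℕ → ℕ → ℕ → ℤ × ℤ → Fin 2 → ℕ × Bool), let Φ := fun k j => Fam k j (V k j) (E k j) (Q k j) (σ k j) (τ k j) (bd k j) (cV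 k j) (cE k j); (∀ k j, 8 ≤ k → (Φ k j).1) → (∃ c : ℝ, 0 < c ∧ ∀ k, 8 ≤ k → ∃ β₀ : ℝ, ∀ β, β₀ ≤ β → ∀ A B : YMSpecies G, Sp A (k / 8) → Sp B (k / 8) → ∃ C j₀, ∀ j, j₀ ≤ j → (Φ k j).2 β (c / k) C A B) → (∃ β₁ : ℝ, ∀ β, β₁ ≤ β → ∃ m : ℝ, 0 < m ∧ ∃ K : ℕ, ∀ k, K ≤ k → ∀ A B : YMSpecies G, Sp A (k / 8) → Sp B (k / 8) → ∃ C j₀, ∀ j, j₀ ≤ j → (Φ k j).2 β m C A B) := by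
  sorry

/-- **Stub O — `stub_uniformOnset`: per-scale gap with a `k`-independent onset (OPEN; lattice
form of 2001 Thm A).** For every compact simple `G`, faithful unitary `r` and every admissible
hyperbolic family `Φ k j` (the route's `Fam` vocabulary, verbatim): IF the anchor holds (as in the
crux), THEN there is ONE `β₁` such that for every `β ≥ β₁` and EVERY curvature scale `k ≥ 8` there is
a rate `m = m(β,k) > 0` with: for all `A, B` of support radius `≤ k/8` there are `C, j₀` such that
for `j ≥ j₀` the clustering bound holds at rate `m`. (The anchor gives this only for `β ≥ β₀(k)`
with `β₀(k) → ∞`; the content is the band `β₁ ≤ β < β₀(k)`, i.e. fixed `k ≳ ξ(β)` through the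
crossover: no re-entrant gapless window at fixed curvature scale.) -/
theorem stub_uniformOnset :
    open Literature.MathematicalPhysics.QuantumFieldTheory Literature.MathematicalPhysics.QuantumLattice MeasureTheory in ∀ (G : Type) [Group G] [TopologicalSpace G] [IsTopologicalGroup G] [CompactSpace G], IsCompactSimpleLieGroup G → letI : MeasurableSpace G := borel G; haveI : BorelSpace G := ⟨rfl⟩; ∀ r : LatticeRep G, let Fam := fun (k j : ℕ) (V E Q : Finset ℕ) (σ τ : ℕ → ℕ) (bd : ℕ → Fin 4 → ℕ × Bool) (cV : ℕ → ℤ × ℤ → ℕ) (cE : ℕ → ℤ × ℤ → Fin 2 → ℕ × Bool) => let st := fun e : ℕ × Bool => if e.2 then σ e.1 else τ e.1; let en := fun e : ℕ × Bool => if e.2 then τ e.1 else σ e.1; let Γ := SimpleGraph.fromRel fun a b : ℕ => ∃ e ∈ E, σ e = a ∧ τ e = b; let dg := fun x : ℕ => (E.filter fun e => σ e = x ∨ τ e = x).card; let K := V.filter fun x => dg x = 5; let F := fun x : ℕ => x ∈ V ∧ ∀ c ∈ K, k / 4 < Γ.dist x c; let Dp := fun x : ℕ => x ∈ V ∧ ∀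 c ∈ K, k / 2 < Γ.dist x c; let ib := fun a : ℤ × ℤ => |a.1| ≤ (k : ℤ) / 4 ∧ |a.2| ≤ (k : ℤ) / 4; let nx := fun (a : ℤ × ℤ) (μ : Fin 2) => if μ = 0 then (a.1 + 1, a.2) else (a.1, a.2 + 1); let Ed := (ℕ × ℕ) ⊕ (ℕ × ℕ); let PE : Finset Ed := (E ×ˢ V).disjSum (V ×ˢ E); let Cfg := ↥PE → G; let ν := Measure.pi fun _ : ↥PE => haarProbability G; let v := fun (U : Cfg) (e : Ed × Bool) => if h : e.1 ∈ PE then (if e.2 then U ⟨e.1, h⟩ else (U ⟨e.1, h⟩)⁻¹) else 1; let w := fun (U : Cfg) (e : Fin 4 → Ed × Bool) => (r.ρ (v U (e 0) * v U (e 1) * v U (e 2) * v U (e 3))).trace.re; let S := fun U : Cfg => (∑ q ∈ Q, ∑ y ∈ V, w U fun i => (Sum.inl ((bd q i).1, y), (bd q i).2)) + (∑ y ∈ V, ∑ q ∈ Q, w U fun i => (Sum.inr (y, (bd q i).1), (bd q i).2)) + ∑ e ∈ E, ∑ e' ∈ E, w U ![(Sum.inl (e, σ e'), true), (Sum.inr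 (τ e, e'), true), (Sum.inl (e, τ e'), false), (Sum.inr (σ e, e'), false)]; let d0 : Fin 4 → Fin 2 := ![0, 1, 0, 1]; let P := fun (x x' : ℕ) (U : Cfg) (p : ZdEdge 4) => let a := (p.1 0, p.1 1); let b := (p.1 2, p.1 3); if p.2 = 0 ∨ p.2 = 1 then v U (Sum.inl ((cE x a (d0 p.2)).1, cV x' b), (cE x a (d0 p.2)).2) else v U (Sum.inr (cV x a, (cE x' b (d0 p.2)).1), (cE x' b (d0 p.2)).2); ((∀ e ∈ E, σ e ∈ V ∧ τ e ∈ V ∧ σ e ≠ τ e) ∧ (∀ q ∈ Q, (∀ i, (bd q i).1 ∈ E) ∧ (∀ i, en (bd q i) = st (bd q (i + 1))) ∧ (st ∘ bd q).Injective) ∧ (∀ e ∈ E, (Q.filter fun q => ∃ i, (bd q i).1 = e).card = 2) ∧ (∀ x ∈ V, (dg x = 4 ∨ dg x = 5) ∧ (Q.filter fun q => ∃ i, st (bd q i) = x).card = dg x) ∧ (∀ x ∈ V, ∃ c ∈ K, Γ.dist x c ≤ k) ∧ (∀ c ∈ K, ∀ c' ∈ K, c ≠ c' → k ≤ Γ.dist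 c c') ∧ (∀ f : ℕ → ℝ, ∑ x ∈ V, f x = 0 → ∑ x ∈ V, f x ^ 2 ≤ 10 ^ 6 * (k : ℝ) ^ 2 * ∑ e ∈ E, (f (σ e) - f (τ e)) ^ 2) ∧ (∃ x y, Dp x ∧ Dp y ∧ j ≤ Γ.dist x y) ∧ (∀ x, F x → cV x (0, 0) = x ∧ (∀ a, ib a → cV x a ∈ V) ∧ Set.InjOn (cV x) {a | ib a} ∧ (∀ a μ, ib a → ib (nx a μ) → (cE x a μ).1 ∈ E ∧ st (cE x a μ) = cV x a ∧ en (cE x a μ) = cV x (nx a μ)) ∧ (∀ a, ib a → ib (a.1 + 1, a.2 + 1) → ∃ q ∈ Q, Finset.univ.image (Prod.fst ∘ bd q) = {(cE x a 0).1, (cE x (nx a 0) 1).1, (cE x (nx a 1) 0).1, (cE x a 1).1})), fun (β m C : ℝ) (A B : YMSpecies G) => let X := fun f : Cfg → ℝ => (∫ U, f U * Real.exp (β * S U) ∂ν) / (∫ U, Real.exp (β * S U) ∂ν); ∀ x x' y y', F x → F x' → F y → F y' → |X (fun U => A.F (P x x' U) * B.F (P y y' U)) - X (fun U => A.F (P x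 x' U)) * X (fun U => B.F (P y y' U))| ≤ C * Real.exp (-(m * ((Γ.dist x y + Γ.dist x' y' : ℕ) : ℝ)))); let Sp := fun (A : YMSpecies G) (R : ℕ) => ∀ p ∈ A.supp, ∀ i, |p.1 i| ≤ (R : ℤ); ∀ (V E Q : ℕ → ℕ → Finset ℕ) (σ τ : ℕ → ℕ → ℕ → ℕ) (bd : ℕ → ℕ → ℕ → Fin 4 → ℕ × Bool) (cV : ℕ → ℕ → ℕ → ℤ × ℤ → ℕ) (cE : ℕ → ℕ → ℕ → ℤ × ℤ → Fin 2 → ℕ × Bool), let Φ := fun k j => Fam k j (V k j) (E k j) (Q k j) (σ k j) (τ k j) (bd k j) (cV k j) (cE k j); (∀ k j, 8 ≤ k → (Φ k j).1) → (∃ c : ℝ, 0 < c ∧ ∀ k, 8 ≤ k → ∃ β₀ : ℝ, ∀ β, β₀ ≤ β → ∀ A B : YMSpecies G, Sp A (k / 8) → Sp B (k / 8) → ∃ C j₀, ∀ j, j₀ ≤ j → (Φ k j).2 β (c / k) C A B) → (∃ β₁ : ℝ, ∀ β, β₁ ≤ β → ∀ k, 8 ≤ k → ∃ m : ℝ, 0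 < m ∧ ∀ A B : YMSpecies G, Sp A (k / 8) → Sp B (k / 8) → ∃ C j₀, ∀ j, j₀ ≤ j → (Φ k j).2 β m C A B) := by
  sorry

/-- Lowering the rate (and replacing the constant by its positive part) preserves an exponential
clustering bound: `C·e^{−m D} ≤ max(C,0)·e^{−m′ D}` for `m′ ≤ m`, `D ≥ 0`. -/
theorem rate_weaken {C m m' D : ℝ} (hm : m' ≤ m) (hD : 0 ≤ D) :
    C * Real.exp (-(m * D)) ≤ max C 0 * Real.exp (-(m' * D)) :=
  (mul_le_mul_of_nonneg_right (le_max_left C 0) (Real.exp_pos _).le).trans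
    (mul_le_mul_of_nonneg_left (Real.exp_le_exp.2 (neg_le_neg (mul_le_mul_of_nonneg_right hm hD)))
      (le_max_right C 0))

/-- **Abstract gluing.** For any clustering predicate `Clus k j β m C A B` that is antitone in the
rate `m` (up to replacing `C` by `max C 0`): an eventually-in-`k` uniform rate (core, `∃ m ∃ K ∀ k ≥ K`)
and per-`k` rates beyond one `k`-independent onset (onset, `∀ k ≥ 8 ∃ m`) give ONE rate for all
`k ≥ 8` — for fixed `β` the window `8 ≤ k < K` is finite, take the minimum. -/
theorem uniform_rate_of_core_of_onset {α : Type*} {Clus : ℕ → ℕ → ℝ → ℝ → ℝ → α → α → Prop}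
    {Sp : α → ℕ → Prop}
    (mono : ∀ k j β m m' C A B, m' ≤ m → Clus k j β m C A B → Clus k j β m' (max C 0) A B)
    (hcore : ∃ β₁ : ℝ, ∀ β, β₁ ≤ β → ∃ m : ℝ, 0 < m ∧ ∃ K : ℕ, ∀ k, K ≤ k → ∀ A B : α,
      Sp A (k / 8) → Sp B (k / 8) → ∃ (C : ℝ) (j₀ : ℕ), ∀ j, j₀ ≤ j → Clus k j β m C A B)
    (honset : ∃ β₁ : ℝ, ∀ β, β₁ ≤ β → ∀ k, 8 ≤ k → ∃ m : ℝ, 0 < m ∧ ∀ A B : α,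
      Sp A (k / 8) → Sp B (k / 8) → ∃ (C : ℝ) (j₀ : ℕ), ∀ j, j₀ ≤ j → Clus k j β m C A B) :
    ∃ β₁ : ℝ, ∀ β, β₁ ≤ β → ∃ m : ℝ, 0 < m ∧ ∀ k, 8 ≤ k → ∀ A B : α,
      Sp A (k / 8) → Sp B (k / 8) → ∃ (C : ℝ) (j₀ : ℕ), ∀ j, j₀ ≤ j → Clus k j β m C A B := by
  classical
  obtain ⟨b₁, h₁⟩ := hcore
  obtain ⟨b₂, h₂⟩ := honset
  refine ⟨max b₁ b₂, fun β hβ => ?_⟩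
  obtain ⟨mA, hmA, K, hK⟩ := h₁ β ((le_max_left _ _).trans hβ)
  have h₂' := h₂ β ((le_max_right _ _).trans hβ)
  choose! mB hmB hB using h₂'
  let T : Finset ℝ := insert mA ((Finset.Ico 8 K).image mB)
  have hT : T.Nonempty := ⟨mA, Finset.mem_insert_self _ _⟩
  refine ⟨T.min' hT, ?_, ?_⟩
  · refine (Finset.lt_min'_iff T hT).2 ?_
    intro y hy
    rcases Finset.mem_insert.1 hy with rfl | hy
    · exact hmA
    · obtain ⟨k, hk, rfl⟩ := Finset.mem_image.1 hy
      exact hmB k (Finset.mem_Ico.1 hk).1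
  · intro k hk A B hSA hSB
    by_cases hkK : K ≤ k
    · obtain ⟨C, j₀, hj⟩ := hK k hkK A B hSA hSB
      have hle : T.min' hT ≤ mA := Finset.min'_le _ _ (Finset.mem_insert_self _ _)
      exact ⟨max C 0, j₀, fun j hj' => mono k j β mA _ C A B hle (hj j hj')⟩
    · have hkI : k ∈ Finset.Ico 8 K := Finset.mem_Ico.2 ⟨hk, lt_of_not_ge hkK⟩
      obtain ⟨C, j₀, hj⟩ := hB k hk A B hSA hSB
      have hle : T.min' hT ≤ mB k :=
        Finset.min'_le _ _ (Finset.mem_insert_of_mem (Finset.mem_image_of_mem _ hkI))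
      exact ⟨max C 0, j₀, fun j hj' => mono k j β (mB k) _ C A B hle (hj j hj')⟩

/-- **Composition (registered form): the two stubs BY NAME give the crux BY NAME.** Fix `G, r`,
the family data and the two hypotheses of the crux; feed both stubs the same data; glue with
`uniform_rate_of_core_of_onset`, the antitonicity of the route's clustering clause in the rate
being `rate_weaken` read through the `let Fam` vocabulary. (`#print axioms` shows `sorryAx` from the
two stubs only; the hypothesis form `CurvatureUniformity_of_hyps` below is the same glue, sorry-free.) -/
theorem CurvatureUniformity_of : CurvatureUniformity := by
  intro G i1 i2 i3 i4 hG r Fam Sp V E Q σ τ bd cV cE Φ hAdm hAnch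
  refine uniform_rate_of_core_of_onset (Clus := fun k j => (Φ k j).2) (Sp := Sp) ?_
    (stub_infraredCore G hG r V E Q σ τ bd cV cE hAdm hAnch)
    (stub_uniformOnset G hG r V E Q σ τ bd cV cE hAdm hAnch)
  intro k j β m m' C A B hm h x x' y y' hx hx' hy hy'
  exact (h x x' y y' hx hx' hy hy').trans (rate_weaken hm (Nat.cast_nonneg _))

/-- **Composition (BC3 hypothesis form, sorry-free): `I-statement → O-statement → CurvatureUniformity`.**
The same glue with the two stub STATEMENTS as explicit hypotheses and no reference to the stubs, so
`#print axioms CurvatureUniformity_of_hyps` = `[propext, Classical.choice, Quot.sound]`. -/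
theorem CurvatureUniformity_of_hyps :
    (open Literature.MathematicalPhysics.QuantumFieldTheory Literature.MathematicalPhysics.QuantumLattice MeasureTheory in ∀ (G : Type) [Group G] [TopologicalSpace G] [IsTopologicalGroup G] [CompactSpace G], IsCompactSimpleLieGroup G → letI : MeasurableSpace G := borel G; haveI : BorelSpace G := ⟨rfl⟩; ∀ r : LatticeRep G, let Fam := fun (k j : ℕ) (V E Q : Finset ℕ) (σ τ : ℕ → ℕ) (bd : ℕ → Fin 4 → ℕ × Bool) (cV : ℕ → ℤ × ℤ → ℕ) (cE : ℕ → ℤ × ℤ → Fin 2 → ℕ × Bool) => let st := fun e : ℕ × Bool => if e.2 then σ e.1 else τ e.1; let en := fun e : ℕ × Bool => if e.2 then τ e.1 else σ e.1; let Γ := SimpleGraph.fromRel fun a b : ℕ => ∃ e ∈ E, σ e = a ∧ τ e = b; let dg := fun x : ℕ => (E.filter fun e => σ e = x ∨ τ e = x).card; let K := V.filter fun x => dg x = 5; let F := fun x : ℕ => x ∈ V ∧ ∀ c ∈ K, k / 4 < Γ.dist x c; let Dp := fun x : ℕ => x ∈ V ∧ ∀ c ∈ K, k / 2 < Γ.dist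 x c; let ib := fun a : ℤ × ℤ => |a.1| ≤ (k : ℤ) / 4 ∧ |a.2| ≤ (k : ℤ) / 4; let nx := fun (a : ℤ × ℤ) (μ : Fin 2) => if μ = 0 then (a.1 + 1, a.2) else (a.1, a.2 + 1); let Ed := (ℕ × ℕ) ⊕ (ℕ × ℕ); let PE : Finset Ed := (E ×ˢ V).disjSum (V ×ˢ E); let Cfg := ↥PE → G; let ν := Measure.pi fun _ : ↥PE => haarProbability G; let v := fun (U : Cfg) (e : Ed × Bool) => if h : e.1 ∈ PE then (if e.2 then U ⟨e.1, h⟩ else (U ⟨e.1, h⟩)⁻¹) else 1; let w := fun (U : Cfg) (e : Fin 4 → Ed × Bool) => (r.ρ (v U (e 0) * v U (e 1) * v U (e 2) * v U (e 3))).trace.re; let S := fun U : Cfg => (∑ q ∈ Q, ∑ y ∈ V, w U fun i => (Sum.inl ((bd q i).1, y), (bd q i).2)) + (∑ y ∈ V, ∑ q ∈ Q, w U fun i => (Sum.inr (y, (bd q i).1), (bd q i).2)) + ∑ e ∈ E, ∑ e' ∈ E, w U ![(Sum.inl (e, σ e'), true), (Sum.inr (τ e, e'), true), (Sum.inl (e,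 τ e'), false), (Sum.inr (σ e, e'), false)]; let d0 : Fin 4 → Fin 2 := ![0, 1, 0, 1]; let P := fun (x x' : ℕ) (U : Cfg) (p : ZdEdge 4) => let a := (p.1 0, p.1 1); let b := (p.1 2, p.1 3); if p.2 = 0 ∨ p.2 = 1 then v U (Sum.inl ((cE x a (d0 p.2)).1, cV x' b), (cE x a (d0 p.2)).2) else v U (Sum.inr (cV x a, (cE x' b (d0 p.2)).1), (cE x' b (d0 p.2)).2); ((∀ e ∈ E, σ e ∈ V ∧ τ e ∈ V ∧ σ e ≠ τ e) ∧ (∀ q ∈ Q, (∀ i, (bd q i).1 ∈ E) ∧ (∀ i, en (bd q i) = st (bd q (i + 1))) ∧ (st ∘ bd q).Injective) ∧ (∀ e ∈ E, (Q.filter fun q => ∃ i, (bd q i).1 = e).card = 2) ∧ (∀ x ∈ V, (dg x = 4 ∨ dg x = 5) ∧ (Q.filter fun q => ∃ i, st (bd q i) = x).card = dg x) ∧ (∀ x ∈ V, ∃ c ∈ K, Γ.dist x c ≤ k) ∧ (∀ c ∈ K, ∀ c' ∈ K, c ≠ c' → k ≤ Γ.dist c c') ∧ (∀ f : ℕ →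 ℝ, ∑ x ∈ V, f x = 0 → ∑ x ∈ V, f x ^ 2 ≤ 10 ^ 6 * (k : ℝ) ^ 2 * ∑ e ∈ E, (f (σ e) - f (τ e)) ^ 2) ∧ (∃ x y, Dp x ∧ Dp y ∧ j ≤ Γ.dist x y) ∧ (∀ x, F x → cV x (0, 0) = x ∧ (∀ a, ib a → cV x a ∈ V) ∧ Set.InjOn (cV x) {a | ib a} ∧ (∀ a μ, ib a → ib (nx a μ) → (cE x a μ).1 ∈ E ∧ st (cE x a μ) = cV x a ∧ en (cE x a μ) = cV x (nx a μ)) ∧ (∀ a, ib a → ib (a.1 + 1, a.2 + 1) → ∃ q ∈ Q, Finset.univ.image (Prod.fst ∘ bd q) = {(cE x a 0).1, (cE x (nx a 0) 1).1, (cE x (nx a 1) 0).1, (cE x a 1).1})), fun (β m C : ℝ) (A B : YMSpecies G) => let X := fun f : Cfg → ℝ => (∫ U, f U * Real.exp (β * S U) ∂ν) / (∫ U, Real.exp (β * S U) ∂ν); ∀ x x' y y', F x → F x' → F y → F y' → |X (fun U => A.F (P x x' U) * B.F (P y y' U)) - X (fun U => A.F (P x x' U)) * X (fun U => B.F (P y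 y' U))| ≤ C * Real.exp (-(m * ((Γ.dist x y + Γ.dist x' y' : ℕ) : ℝ)))); let Sp := fun (A : YMSpecies G) (R : ℕ) => ∀ p ∈ A.supp, ∀ i, |p.1 i| ≤ (R : ℤ); ∀ (V E Q : ℕ → ℕ → Finset ℕ) (σ τ : ℕ → ℕ → ℕ → ℕ) (bd : ℕ → ℕ → ℕ → Fin 4 → ℕ × Bool) (cV : ℕ → ℕ → ℕ → ℤ × ℤ → ℕ) (cE : ℕ → ℕ → ℕ → ℤ × ℤ → Fin 2 → ℕ × Bool), let Φ := fun k j => Fam k j (V k j) (E k j) (Q k j) (σ k j) (τ k j) (bd k j) (cV k j) (cE k j); (∀ k j, 8 ≤ k → (Φ k j).1) → (∃ c : ℝ, 0 < c ∧ ∀ k, 8 ≤ k → ∃ β₀ : ℝ, ∀ β, β₀ ≤ β → ∀ A B : YMSpecies G, Sp A (k / 8) → Sp B (k / 8) → ∃ C j₀, ∀ j, j₀ ≤ j → (Φ k j).2 β (c / k) C A B) → (∃ β₁ : ℝ, ∀ β, β₁ ≤ β → ∃ m : ℝ, 0 < m ∧ ∃ K : ℕ, ∀ k, K ≤ k → ∀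 A B : YMSpecies G, Sp A (k / 8) → Sp B (k / 8) → ∃ C j₀, ∀ j, j₀ ≤ j → (Φ k j).2 β m C A B)) →
    (open Literature.MathematicalPhysics.QuantumFieldTheory Literature.MathematicalPhysics.QuantumLattice MeasureTheory in ∀ (G : Type) [Group G] [TopologicalSpace G] [IsTopologicalGroup G] [CompactSpace G], IsCompactSimpleLieGroup G → letI : MeasurableSpace G := borel G; haveI : BorelSpace G := ⟨rfl⟩; ∀ r : LatticeRep G, let Fam := fun (k j : ℕ) (V E Q : Finset ℕ) (σ τ : ℕ → ℕ) (bd : ℕ → Fin 4 → ℕ × Bool) (cV : ℕ → ℤ × ℤ → ℕ) (cE : ℕ → ℤ × ℤ → Fin 2 → ℕ × Bool) => let st := fun e : ℕ × Bool => if e.2 then σ e.1 else τ e.1; let en := fun e : ℕ × Bool => if e.2 then τ e.1 else σ e.1; let Γ := SimpleGraph.fromRel fun a b : ℕ => ∃ e ∈ E, σ e = a ∧ τ e = b; let dg := fun x : ℕ => (E.filter fun e => σ e = x ∨ τ e = x).card; let K := V.filter fun x => dg x = 5; let F := fun x : ℕ => x ∈ V ∧ ∀ c ∈ K, k / 4 <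 Γ.dist x c; let Dp := fun x : ℕ => x ∈ V ∧ ∀ c ∈ K, k / 2 < Γ.dist x c; let ib := fun a : ℤ × ℤ => |a.1| ≤ (k : ℤ) / 4 ∧ |a.2| ≤ (k : ℤ) / 4; let nx := fun (a : ℤ × ℤ) (μ : Fin 2) => if μ = 0 then (a.1 + 1, a.2) else (a.1, a.2 + 1); let Ed := (ℕ × ℕ) ⊕ (ℕ × ℕ); let PE : Finset Ed := (E ×ˢ V).disjSum (V ×ˢ E); let Cfg := ↥PE → G; let ν := Measure.pi fun _ : ↥PE => haarProbability G; let v := fun (U : Cfg) (e : Ed × Bool) => if h : e.1 ∈ PE then (if e.2 then U ⟨e.1, h⟩ else (U ⟨e.1, h⟩)⁻¹) else 1; let w := fun (U : Cfg) (e : Fin 4 → Ed × Bool) => (r.ρ (v U (e 0) * v U (e 1) * v U (e 2) * v U (e 3))).trace.re; let S := fun U : Cfg => (∑ q ∈ Q, ∑ y ∈ V, w U fun i => (Sum.inl ((bd q i).1, y), (bd q i).2)) + (∑ y ∈ V, ∑ q ∈ Q, w U fun i => (Sum.inr (y, (bd q i).1), (bd q i).2)) + ∑ e ∈ E, ∑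 e' ∈ E, w U ![(Sum.inl (e, σ e'), true), (Sum.inr (τ e, e'), true), (Sum.inl (e, τ e'), false), (Sum.inr (σ e, e'), false)]; let d0 : Fin 4 → Fin 2 := ![0, 1, 0, 1]; let P := fun (x x' : ℕ) (U : Cfg) (p : ZdEdge 4) => let a := (p.1 0, p.1 1); let b := (p.1 2, p.1 3); if p.2 = 0 ∨ p.2 = 1 then v U (Sum.inl ((cE x a (d0 p.2)).1, cV x' b), (cE x a (d0 p.2)).2) else v U (Sum.inr (cV x a, (cE x' b (d0 p.2)).1), (cE x' b (d0 p.2)).2); ((∀ e ∈ E, σ e ∈ V ∧ τ e ∈ V ∧ σ e ≠ τ e) ∧ (∀ q ∈ Q, (∀ i, (bd q i).1 ∈ E) ∧ (∀ i, en (bd q i) = st (bd q (i + 1))) ∧ (st ∘ bd q).Injective) ∧ (∀ e ∈ E, (Q.filter fun q => ∃ i, (bd q i).1 = e).card = 2) ∧ (∀ x ∈ V, (dg x = 4 ∨ dg x = 5) ∧ (Q.filter fun q => ∃ i, st (bd q i) = x).card = dg x) ∧ (∀ x ∈ V, ∃ c ∈ K, Γ.dist x c ≤ k) ∧ (∀ c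 ∈ K, ∀ c' ∈ K, c ≠ c' → k ≤ Γ.dist c c') ∧ (∀ f : ℕ → ℝ, ∑ x ∈ V, f x = 0 → ∑ x ∈ V, f x ^ 2 ≤ 10 ^ 6 * (k : ℝ) ^ 2 * ∑ e ∈ E, (f (σ e) - f (τ e)) ^ 2) ∧ (∃ x y, Dp x ∧ Dp y ∧ j ≤ Γ.dist x y) ∧ (∀ x, F x → cV x (0, 0) = x ∧ (∀ a, ib a → cV x a ∈ V) ∧ Set.InjOn (cV x) {a | ib a} ∧ (∀ a μ, ib a → ib (nx a μ) → (cE x a μ).1 ∈ E ∧ st (cE x a μ) = cV x a ∧ en (cE x a μ) = cV x (nx a μ)) ∧ (∀ a, ib a → ib (a.1 + 1, a.2 + 1) → ∃ q ∈ Q, Finset.univ.image (Prod.fst ∘ bd q) = {(cE x a 0).1, (cE x (nx a 0) 1).1, (cE x (nx a 1) 0).1, (cE x a 1).1})), fun (β m C : ℝ) (A B : YMSpecies G) => let X := fun f : Cfg → ℝ => (∫ U, f U * Real.exp (β * S U) ∂ν) / (∫ U, Real.exp (β * S U) ∂ν); ∀ x x' y y', F x → F x' → F y → F y' → |X (fun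 U => A.F (P x x' U) * B.F (P y y' U)) - X (fun U => A.F (P x x' U)) * X (fun U => B.F (P y y' U))| ≤ C * Real.exp (-(m * ((Γ.dist x y + Γ.dist x' y' : ℕ) : ℝ)))); let Sp := fun (A : YMSpecies G) (R : ℕ) => ∀ p ∈ A.supp, ∀ i, |p.1 i| ≤ (R : ℤ); ∀ (V E Q : ℕ → ℕ → Finset ℕ) (σ τ : ℕ → ℕ → ℕ → ℕ) (bd : ℕ → ℕ → ℕ → Fin 4 → ℕ × Bool) (cV : ℕ → ℕ → ℕ → ℤ × ℤ → ℕ) (cE : ℕ → ℕ → ℕ → ℤ × ℤ → Fin 2 → ℕ × Bool), let Φ := fun k j => Fam k j (V k j) (E k j) (Q k j) (σ k j) (τ k j) (bd k j) (cV k j) (cE k j); (∀ k j, 8 ≤ k → (Φ k j).1) → (∃ c : ℝ, 0 < c ∧ ∀ k, 8 ≤ k → ∃ β₀ : ℝ, ∀ β, β₀ ≤ β → ∀ A B : YMSpecies G, Sp A (k / 8) → Sp B (k / 8) → ∃ C j₀, ∀ j, j₀ ≤ j → (Φ k j).2 β (c / k) C A B) → (∃ β₁ : ℝ, ∀ β,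 β₁ ≤ β → ∀ k, 8 ≤ k → ∃ m : ℝ, 0 < m ∧ ∀ A B : YMSpecies G, Sp A (k / 8) → Sp B (k / 8) → ∃ C j₀, ∀ j, j₀ ≤ j → (Φ k j).2 β m C A B)) →
    CurvatureUniformity := by
  intro hA hB G i1 i2 i3 i4 hG r Fam Sp V E Q σ τ bd cV cE Φ hAdm hAnch
  refine uniform_rate_of_core_of_onset (Clus := fun k j => (Φ k j).2) (Sp := Sp) ?_
    (hA G hG r V E Q σ τ bd cV cE hAdm hAnch) (hB G hG r V E Q σ τ bd cV cE hAdm hAnch)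
  intro k j β m m' C A B hm h x x' y y' hx hx' hy hy'
  exact (h x x' y y' hx hx' hy hy').trans (rate_weaken hm (Nat.cast_nonneg _))

/-- The registered composition is an instance of the hypothesis form at the stubs. -/
example : CurvatureUniformity := CurvatureUniformity_of_hyps stub_infraredCore stub_uniformOnset

/-- Signature match: the composition concludes literally the route's crux decl. -/
example : Summit.QuantumFields.YangMills.Theses.HyperbolicRegulator.CurvatureUniformity :=
  CurvatureUniformity_of

end Summit.QuantumFields.YangMills.Cruxes.CurvatureUniformity.Birth
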